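import Mathlib.Algebra.BigOperators.Finprod
import Mathlib.MeasureTheory.Integral.Bochner.Set
import Literature.MathematicalPhysics.KineticTheory.HardSphereEuler
import Literature.Analysis.FluidPDE.HardSphereCollisionRecord
import HarnessLib

/-!
# The Metropolis-weighted odd contact statistic

Topic `Literature/MathematicalPhysics/KineticTheory` — companion of `CollisionTubeFunctional.lean` (which
names the rev-1 statistic `oddStat` with the unbounded reweighting `1 + e^{−F}`).  This file names the
rev-5 statistic of the crux `JParityClosure.OddContactSymmetry` (item `stmt-AtomisticToContinuum-17722`),
whose reweighting is the METROPOLIS ACCEPTANCE `min(1, e^{−F})` of the inverse-collision proposal against the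
chaotic reference (Hastings 1970; Metropolis et al.; the pointwise-maximal parity-exact sub-unit weight),
as three honest functionals of a hard-sphere configuration / initial datum on the flat torus `𝕋³` at
fixed reduced density `σ` (`N + 1` spheres of diameter `ε = hsDiameter σ N`):

* `metroOddMark σ N χ g Ψ r ϑ s z i j` — the mark of ONE ordered contact pair `(i, j)` of the configuration
  `z` at time `s`: `χ(s, xᵢ) · g(σ³ ρ_r(xᵢ)) · Ψ(ε⁻¹ sepVec xᵢ xⱼ, vᵢ⁻, vⱼ⁻) · min(1, e^{−F})`, where
  `ρ_r` / `h = h_{r,ϑ}` are the empirical density / one-particle law of `z` mollified at space scale `r`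
  (cone kernel) and velocity scale `ϑ` (Gaussian), `(vᵢ⁻, vⱼ⁻) = reflectVel (sepVec xᵢ xⱼ) (vᵢ, vⱼ)` are the
  pre-collisional velocities read off the (post-collisional, right-continuous) configuration, and
  `F = log h(vᵢ⁻) + log h(vⱼ⁻) − log h(vᵢ) − log h(vⱼ)` is the surprisal jump (all read at `xᵢ`).
* `metroOddSum σ N Φ S χ g Ψ r ϑ z` — the UNNORMALISED sum of the marks over the collision times `s ∈ S`
  of the orbit `s ↦ Φ.flow s z` and the ordered contact pairs at time `s` (inline `finsum`/`ite` form of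
  the route; `= HardSphereFlow.collisionPairSum` on orbits in the hard-sphere domain,
  `metroOddSum_eq_collisionPairSum`).  Windows `S` other than `[0, τ]` (kinetic slabs `(s, s + ℓ]`) and
  reading scales `r` other than a fixed one (the kinetic mesoscale `K^{1/4}(N+1)^{-1/3}`) are what the
  crux lines `kinetic-slab-entropy-spending` / `gaussian-branch-window-transfer` consume.
* `metroOddStat σ N Φ τ χ g Ψ r ϑ z` — the crux statistic `D(z) = K_N[χ g Ψ min(1,e^{−F})](z)` itself:
  LITERALLY the `let`-chain of the route declaration for one `N` and one flow (so the crux reads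
  `… localGibbsLaw … {z | η < |metroOddStat σ N (Φ N) τ χ g Ψ r ϑ z|} ≤ δ` by `Iff.rfl`), and
  `metroOddStat = (ε/(N+1)) · metroOddSum … (Icc 0 τ) …` definitionally (`metroOddStat_eq`).

API: `metroOddStat_eq` (rfl), `metroOddSum_eq_collisionPairSum`, the weight bounds
`minWeight_nonneg` / `minWeight_le_one`, and the sup bound `abs_metroOddMark_le`
(`|mark| ≤ C_χ C_g C_Ψ`: the Metropolis weight lies in `[0, 1]`, which is the whole point of rev 5).

## References

* W. K. Hastings, *Monte Carlo sampling methods using Markov chains and their applications*,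
  Biometrika 57 (1970) 97–109, §2 (the acceptance class `a(F) = e^{−F} a(−F)`; Metropolis' `min(1, e^{−F})`).
  [Hastings1970]
* P. H. Peskun, *Optimum Monte-Carlo sampling using Markov chains*, Biometrika 60 (1973) 607–612
  (Metropolis acceptance is the pointwise-maximal member).  [Peskun1973]
* I. Gallagher, L. Saint-Raymond, B. Texier, *From Newton to Boltzmann* (2013), §4.1 (hard-sphere flow,
  pre- and post-collisional velocities).  [GST2013]
* H. Spohn, *Large Scale Dynamics of Interacting Particles* (1991), Part I Ch. 3 (Euler scaling at fixed
  reduced density).  [Spohn1991]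

## Not here

No measurability, no law, no limit statement: pure definitions plus elementary bounds.  The rev-1 statistic
and the fixed-time tube functional stay in `CollisionTubeFunctional.lean`.
-/

noncomputable section

open scoped BigOperators Classical InnerProductSpace ENNReal
open Set MeasureTheory
open Literature.Analysis.FluidPDE

namespace Literature.MathematicalPhysics.KineticTheory

/-! ## Definitions -/

/-- **The Metropolis-weighted odd mark of one ordered contact pair.**  For a configuration `z` of `N + 1`
spheres of reduced diameter `σ` on `𝕋³`, a time `s` and an ordered pair `(i, j)`:
`χ(s, xᵢ) · g(σ³ ρ_r(xᵢ)) · (Ψ(ε⁻¹ sepVec xᵢ xⱼ, vᵢ⁻, vⱼ⁻) · min(1, e^{−F}))` with `ρ_r`, `h_{r,ϑ}` the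
cone- and Gaussian-mollified empirical density and one-particle law of `z`, `(vᵢ⁻, vⱼ⁻) = reflectVel (sepVec xᵢ xⱼ)
(vᵢ, vⱼ)` and `F = log h(vᵢ⁻) + log h(vⱼ⁻) − log h(vᵢ) − log h(vⱼ)` (read at `xᵢ`).  Verbatim the summand of the
`let`-chain of `JParityClosure.OddContactSymmetry` (rev 5), as a function of the current configuration.
[cite: Hastings1970, §2] -/
def metroOddMark (σ : ℝ) (N : ℕ) (χ : ℝ × UnitAddTorus (Fin 3) → ℝ) (g : ℝ → ℝ)
    (Ψ : EuclideanSpace ℝ (Fin 3) × EuclideanSpace ℝ (Fin 3) × EuclideanSpace ℝ (Fin 3) → ℝ)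
    (r ϑ : ℝ) (s : ℝ) (z : Config (N + 1) (Fin 3) T3) (i j : Fin (N + 1)) : ℝ :=
  let ε := Literature.MathematicalPhysics.KineticTheory.hsDiameter σ N
  let G := Literature.Analysis.FluidPDE.Torus.geometry (Fin 3)
  let bx : UnitAddTorus (Fin 3) → UnitAddTorus (Fin 3) → ℝ := fun x y => 3 / (Real.pi * r ^ 3) * max (1 - Literature.Analysis.FluidPDE.Torus.euclidDist x y / r) 0
  let ρm := fun (x₀ : UnitAddTorus (Fin 3)) => ∫ q, bx q.1 x₀ ∂(Literature.Analysis.FluidPDE.empiricalMeasure z)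
  let hm := fun (x₀ : UnitAddTorus (Fin 3)) (v : EuclideanSpace ℝ (Fin 3)) => ∫ q, bx q.1 x₀ * Literature.Analysis.FluidPDE.localMaxwellian 1 (ϑ ^ 2) v q.2 ∂(Literature.Analysis.FluidPDE.empiricalMeasure z)
  let pv := Literature.Analysis.FluidPDE.reflectVel (G.sepVec (z i).1 (z j).1) ((z i).2, (z j).2)
  let F := Real.log (hm (z i).1 pv.1) + Real.log (hm (z i).1 pv.2) - Real.log (hm (z i).1 (z i).2) - Real.log (hm (z i).1 (z j).2)
  χ (s, (z i).1) * g (σ ^ 3 * ρm (z i).1) * (Ψ (ε⁻¹ • G.sepVec (z i).1 (z j).1, pv.1, pv.2) * min 1 (Real.exp (-F)))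

/-- **The unnormalised Metropolis-odd collision sum over a time window `S`.**  The sum over the collision times
`s ∈ S` of the orbit `s ↦ Φ.flow s z` and over the ordered contact pairs `(i, j)` (`i ≠ j`,
`‖sepVec xᵢ xⱼ‖ = ε`) at time `s` of `metroOddMark … s (Φ.flow s z) i j` (inline `finsum`/`ite` form of the
route; junk value `0` of `finsum` when infinitely many collision times lie in `S`, excluded on `Φ.good` for
bounded `S`).  No `ε/(N+1)` prefactor: routes and lines put their own normalisation. [cite: Hastings1970, §2] -/
def metroOddSum (σ : ℝ) (N : ℕ)
    (Φ : HardSphereFlow (Torus.geometry (Fin 3)) (hsDiameter σ N) (N + 1)) (S : Set ℝ)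
    (χ : ℝ × UnitAddTorus (Fin 3) → ℝ) (g : ℝ → ℝ)
    (Ψ : EuclideanSpace ℝ (Fin 3) × EuclideanSpace ℝ (Fin 3) × EuclideanSpace ℝ (Fin 3) → ℝ)
    (r ϑ : ℝ) (z : Config (N + 1) (Fin 3) T3) : ℝ :=
  let ε := Literature.MathematicalPhysics.KineticTheory.hsDiameter σ N
  let G := Literature.Analysis.FluidPDE.Torus.geometry (Fin 3)
  ∑ᶠ (s : ℝ) (_ : s ∈ Literature.Analysis.FluidPDE.collisionTimes G ε (fun t => Φ.flow t z) ∩ S),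
    ∑ i : Fin (N + 1), ∑ j : Fin (N + 1),
      (if i ≠ j ∧ ‖G.sepVec (Φ.flow s z i).1 (Φ.flow s z j).1‖ = ε then
        metroOddMark σ N χ g Ψ r ϑ s (Φ.flow s z) i j else 0)

/-- **The crux statistic `D(z) = K_N[χ g Ψ min(1, e^{−F})](z)` of `JParityClosure.OddContactSymmetry` (rev 5)**
for one particle number `N` and one hard-sphere flow `Φ` on `𝕋³` at reduced diameter `σ`: LITERALLY the
`let`-chain of the route declaration (with `(Φ N).flow ↦ Φ.flow`), i.e. the `ε/(N+1)`-weighted sum over the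
collision times in `[0, τ]` and the ordered contact pairs of the Metropolis-weighted odd mark.  Kept verbatim
(rather than defined as `ε/(N+1) * metroOddSum …`) so that the crux is this functional by `Iff.rfl`; the
factorisation is `metroOddStat_eq` (also `rfl`). [cite: Hastings1970, §2] -/
def metroOddStat (σ : ℝ) (N : ℕ)
    (Φ : HardSphereFlow (Torus.geometry (Fin 3)) (hsDiameter σ N) (N + 1))
    (τ : ℝ) (χ : ℝ × UnitAddTorus (Fin 3) → ℝ) (g : ℝ → ℝ)
    (Ψ : EuclideanSpace ℝ (Fin 3) × EuclideanSpace ℝ (Fin 3) × EuclideanSpace ℝ (Fin 3) → ℝ)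
    (r ϑ : ℝ) (z : Config (N + 1) (Fin 3) T3) : ℝ :=
  let ε := Literature.MathematicalPhysics.KineticTheory.hsDiameter σ N
  let G := Literature.Analysis.FluidPDE.Torus.geometry (Fin 3)
  let γ := fun z (s : ℝ) => Φ.flow s z
  let bx : UnitAddTorus (Fin 3) → UnitAddTorus (Fin 3) → ℝ := fun x y => 3 / (Real.pi * r ^ 3) * max (1 - Literature.Analysis.FluidPDE.Torus.euclidDist x y / r) 0
  let ρm := fun z s (x₀ : UnitAddTorus (Fin 3)) => ∫ q, bx q.1 x₀ ∂(Literature.Analysis.FluidPDE.empiricalMeasure (γ z s))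
  let hm := fun z s (x₀ : UnitAddTorus (Fin 3)) (v : EuclideanSpace ℝ (Fin 3)) => ∫ q, bx q.1 x₀ * Literature.Analysis.FluidPDE.localMaxwellian 1 (ϑ ^ 2) v q.2 ∂(Literature.Analysis.FluidPDE.empiricalMeasure (γ z s))
  let pv := fun z s (i j : Fin (N + 1)) => Literature.Analysis.FluidPDE.reflectVel (G.sepVec (γ z s i).1 (γ z s j).1) ((γ z s i).2, (γ z s j).2)
  let F := fun z s (i j : Fin (N + 1)) => Real.log (hm z s (γ z s i).1 (pv z s i j).1) + Real.log (hm z s (γ z s i).1 (pv z s i j).2) - Real.log (hm z s (γ z s i).1 (γ z s i).2) - Real.log (hm z s (γ z s i).1 (γ z s j).2)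
  let Kc := fun (Fn : Literature.Analysis.FluidPDE.Config (N + 1) (Fin 3) Literature.MathematicalPhysics.KineticTheory.T3 → ℝ → Fin (N + 1) → Fin (N + 1) → ℝ) z => ε / (N + 1 : ℝ) * ∑ᶠ (s : ℝ) (_ : s ∈ Literature.Analysis.FluidPDE.collisionTimes G ε (γ z) ∩ Set.Icc 0 τ), ∑ i : Fin (N + 1), ∑ j : Fin (N + 1), (if i ≠ j ∧ ‖G.sepVec (γ z s i).1 (γ z s j).1‖ = ε then Fn z s i j else 0)
  let D := fun z => Kc (fun z s i j => χ (s, (γ z s i).1) * g (σ ^ 3 * ρm z s (γ z s i).1) * (Ψ (ε⁻¹ • G.sepVec (γ z s i).1 (γ z s j).1, (pv z s i j).1, (pv z s i j).2) * min 1 (Real.exp (-F z s i j)))) z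
  D z

/-! ## API -/

section API

variable {σ : ℝ} {N : ℕ} {χ : ℝ × UnitAddTorus (Fin 3) → ℝ} {g : ℝ → ℝ}
  {Ψ : EuclideanSpace ℝ (Fin 3) × EuclideanSpace ℝ (Fin 3) × EuclideanSpace ℝ (Fin 3) → ℝ}
  {r ϑ : ℝ}

/-- **Factorisation of the crux statistic** (definitional): `D = (ε/(N+1)) · metroOddSum … (Icc 0 τ) …`.
[folklore] -/
theorem metroOddStat_eq (Φ : HardSphereFlow (Torus.geometry (Fin 3)) (hsDiameter σ N) (N + 1))
    (τ : ℝ) (z : Config (N + 1) (Fin 3) T3) :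
    metroOddStat σ N Φ τ χ g Ψ r ϑ z =
      hsDiameter σ N / (N + 1 : ℝ) * metroOddSum σ N Φ (Set.Icc 0 τ) χ g Ψ r ϑ z :=
  rfl

/-- **The collision-record form.**  On an orbit that stays in the hard-sphere domain (every orbit of a good
initial datum) the inline sum is the `HardSphereFlow.collisionPairSum` of the Metropolis-odd mark, so the window
API of `HardSphereCollisionRecord` (additivity `collisionPairSum_union`, finite-sum forms) applies. [folklore] -/
theorem metroOddSum_eq_collisionPairSum
    (Φ : HardSphereFlow (Torus.geometry (Fin 3)) (hsDiameter σ N) (N + 1)) (S : Set ℝ)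
    {z : Config (N + 1) (Fin 3) T3}
    (hz : ∀ t, Φ.flow t z ∈ hardSphereDomain (Torus.geometry (Fin 3)) (N + 1) (hsDiameter σ N)) :
    metroOddSum σ N Φ S χ g Ψ r ϑ z =
      Φ.collisionPairSum S (fun t z' i j => metroOddMark σ N χ g Ψ r ϑ t z' i j) z := by
  unfold metroOddSum HardSphereFlow.collisionPairSum
  exact (collisionPairSum_eq_finsum_ite (G := Torus.geometry (Fin 3)) (γ := fun t => Φ.flow t z) hz S
    (fun t i j => metroOddMark σ N χ g Ψ r ϑ t (Φ.flow t z) i j)).symm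

/-- On a good initial datum the inline sum is the collision pair sum of the mark. [folklore] -/
theorem metroOddSum_eq_collisionPairSum_of_mem_good
    (Φ : HardSphereFlow (Torus.geometry (Fin 3)) (hsDiameter σ N) (N + 1)) (S : Set ℝ)
    {z : Config (N + 1) (Fin 3) T3} (hz : z ∈ Φ.good) :
    metroOddSum σ N Φ S χ g Ψ r ϑ z =
      Φ.collisionPairSum S (fun t z' i j => metroOddMark σ N χ g Ψ r ϑ t z' i j) z :=
  metroOddSum_eq_collisionPairSum Φ S fun t => (Φ.isTrajectory z hz).mem t

/-- The Metropolis weight is nonnegative. [folklore] -/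
theorem minWeight_nonneg (F : ℝ) : 0 ≤ min 1 (Real.exp (-F)) :=
  le_min zero_le_one (Real.exp_pos _).le

/-- The Metropolis weight is at most `1` (the rev-5 repair: no velocity-hole blow-up). [folklore] -/
theorem minWeight_le_one (F : ℝ) : min 1 (Real.exp (-F)) ≤ 1 :=
  min_le_left _ _

/-- Elementary bound for one mark `χ · g · (Ψ · m)` with `0 ≤ m ≤ 1`. [folklore] -/
theorem abs_mul_mul_mul_le {x₁ x₂ x₃ m C₁ C₂ C₃ : ℝ} (h₁ : |x₁| ≤ C₁) (h₂ : |x₂| ≤ C₂)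
    (h₃ : |x₃| ≤ C₃) (hm0 : 0 ≤ m) (hm1 : m ≤ 1) :
    |x₁ * x₂ * (x₃ * m)| ≤ C₁ * C₂ * C₃ := by
  have hC₁ : 0 ≤ C₁ := (abs_nonneg _).trans h₁
  have hC₃ : 0 ≤ C₃ := (abs_nonneg _).trans h₃
  have hm : |m| ≤ 1 := by rwa [abs_of_nonneg hm0]
  rw [abs_mul, abs_mul, abs_mul]
  calc |x₁| * |x₂| * (|x₃| * |m|) ≤ C₁ * C₂ * (C₃ * 1) :=
        mul_le_mul (mul_le_mul h₁ h₂ (abs_nonneg _) hC₁) (mul_le_mul h₃ hm (abs_nonneg _) hC₃)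
          (by positivity) (mul_nonneg hC₁ ((abs_nonneg _).trans h₂))
    _ = C₁ * C₂ * C₃ := by ring

/-- **Sup bound for the Metropolis-odd mark.**  If `|χ| ≤ C_χ`, `|g| ≤ C_g` and `|Ψ| ≤ C_Ψ` pointwise then
`|metroOddMark …| ≤ C_χ C_g C_Ψ`: the Metropolis weight lies in `[0, 1]`, so per collision the statistic is
bounded by the marks alone (`|D| ≤ ‖χ g Ψ‖_∞ · K_N[1]` pathwise). [folklore] -/
theorem abs_metroOddMark_le {Cχ Cg CΨ : ℝ} (hχ : ∀ p, |χ p| ≤ Cχ) (hg : ∀ a, |g a| ≤ Cg)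
    (hΨ : ∀ q, |Ψ q| ≤ CΨ) (s : ℝ) (z : Config (N + 1) (Fin 3) T3) (i j : Fin (N + 1)) :
    |metroOddMark σ N χ g Ψ r ϑ s z i j| ≤ Cχ * Cg * CΨ := by
  dsimp only [metroOddMark]
  exact abs_mul_mul_mul_le (hχ _) (hg _) (hΨ _) (minWeight_nonneg _) (minWeight_le_one _)

end API

end Literature.MathematicalPhysics.KineticTheory

end
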